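import Summits.RiemannHypothesis.RiemannHypothesis.Theorems.JensenPolynomialsAnalyticSplitGlue
import Summits.RiemannHypothesis.RiemannHypothesis.Theorems.JensenPolynomialsTailOfZeroFree
import Summits.RiemannHypothesis.RiemannHypothesis.Theorems.JensenPolynomialsXiDeltaLower
import Summits.RiemannHypothesis.RiemannHypothesis.Theses.JensenPolynomials

/-!
# Route `JensenPolynomials` (rev ≥ 9, RE-PIN N₁ = 2·10¹⁸) — the FAR split glue item `XiGorttwCoeffSmallFarOfSplit`
PROVED (RH-FREE proof-of-data; cell rh-jensen, HUMAN RULING D-0040)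

`XiWindowZeroFreeRelFar → XiCumulantSkew98Far → XiCumulantMajorantCapFar → XiGorttwCoeffSmallFar` (the glue of the far
split of the analytic crux, theory g7's RE-PIN 2026-08-26 rev 9/10): the proof of the `10⁴`-pinned glue (p420393,
`JensenPolynomialsAnalyticSplitGlue`) with `10⁴ ↦ 2·10¹⁸`, the effective Turán floor `δ(M) = 2MΔ(M)² ≥ 13/25` for
`M ≥ 10⁴` being supplied UNCONDITIONALLY by `two_mul_gorttwDeltaSq_ge` (`JensenPolynomialsXiDeltaLower`, item
`XiDeltaLower052`, one-cell Brascamp–Lieb). Ingredients: C0 `xiCumulantIdentity_holds` (p413598), G3-rel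
`hermiteCumulant_abs_le_of_zeroFreeRel` (p415479; θ = 7/20, η = 1, δ₀ = 13/25, 16θ²δ₀ ≥ 1), the k = 3 cap from the skew
law `hermiteCumulant_three_le_cap_of_q`, and `xiGorttwCoeffSmallFrom_of_splitGenFrom`. Closer:
`xiGorttwCoeffSmallFarOfSplit_item`. WHAT THIS IS NOT: nothing here bears on the zeros of `ζ`; the three far children remain
open cruxes. (Sketch: HOME rh-jensen-theory/g7/repin/RepinSketch.lean §2.)
-/

noncomputable section
-- D-0017: `Summit.RiemannHypothesis.RiemannHypothesis.…` duplicates the namespace BY DESIGN (single-problem summit).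
set_option linter.dupNamespace false

namespace Summit.RiemannHypothesis.RiemannHypothesis.Theorems.JensenPolynomials

open Literature.NumberTheory.LFunctions Finset

/-- **The far split glue** (route `JensenPolynomials`, rev ≥ 9): B1-rel FAR, an effective δ-floor `δ(M) ≥ 13/25` from
`M ≥ 10⁴`, the skew cap C1a FAR and the γ-free majorant C2⁺ FAR give the far coefficient-smallness crux
`XiGorttwCoeffSmallFrom rhoWinMin (2·10¹⁸)` (theory g7's RepinSketch §2: p420393's proof with `10⁴ ↦ 2·10¹⁸`). -/
theorem xiGorttwCoeffSmallFar_of_split4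
    (hB1 : Summit.RiemannHypothesis.RiemannHypothesis.Theses.JensenPolynomials.XiWindowZeroFreeRelFar)
    (hδ : ∀ M : ℕ, 10000 ≤ M → (13 / 25 : ℝ) ≤ 2 * (M : ℝ) * gorttwDeltaSq xiTaylorCoeff M)
    (hq : Summit.RiemannHypothesis.RiemannHypothesis.Theses.JensenPolynomials.XiCumulantSkew98Far)
    (h2 : Summit.RiemannHypothesis.RiemannHypothesis.Theses.JensenPolynomials.XiCumulantMajorantCapFar) :
    Summit.RiemannHypothesis.RiemannHypothesis.Theses.JensenPolynomials.XiGorttwCoeffSmallFar := by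
  have h18 : (10 : ℕ) ^ 18 = 1000000000000000000 := by norm_num
  have hfar4 : ∀ M : ℕ, 2 * 10 ^ 18 ≤ M → 10000 ≤ M := fun M hM => by omega
  have hΔ : ∀ M : ℕ, 2 * 10 ^ 18 ≤ M → 0 < gorttwDeltaSq xiTaylorCoeff M := by
    intro M hM
    have hMpos : (0 : ℝ) < (M : ℝ) := by exact_mod_cast (show 0 < M by omega)
    have h := hδ M (hfar4 M hM)
    by_contra hle
    rw [not_lt] at hle
    have : 2 * (M : ℝ) * gorttwDeltaSq xiTaylorCoeff M ≤ 0 :=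
      mul_nonpos_of_nonneg_of_nonpos (by positivity) hle
    linarith
  have h1 : XiCumulantEnvelopeGen jensenCap (2 * 10 ^ 18) := by
    intro M k hM hk3 hkM
    have hM1 : 1 ≤ M := by have := hfar4 M hM; omega
    rcases Nat.lt_or_ge k 4 with hlt | hge
    · have hk : k = 3 := by omega
      subst hk
      exact hermiteCumulant_three_le_cap_of_q hM1 (hq M hM)
    · have hkM' : k ≤ M := by
        have : k ≤ k ^ 3 := Nat.le_self_pow (by norm_num) k
        omega
      have hG3 := hermiteCumulant_abs_le_of_zeroFreeRel xiTaylorCoeff M (7 / 20) 1 (13 / 25) (by norm_num) le_rfl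
        (by norm_num) hM1 (hΔ M hM) (hδ M (hfar4 M hM)) (hB1 M hM) k hge hkM'
      have hcap : jensenCap k = (k : ℝ) * 4 ^ (k - 3) / 3 := by
        simp [jensenCap, show ¬ k ≤ 3 by omega]
      unfold envCapGen
      rw [hcap]
      exact hG3
  have h2' : CumulantMajorantSumGen jensenCap rhoWinMin (2 * 10 ^ 18) := by
    intro d hd
    exact h2 d hd
  exact xiGorttwCoeffSmallFrom_of_splitGenFrom jensenCap_nonneg (fun d j hd hj _ => rhoWinMin_nonneg d j hd hj)
    xiCumulantIdentity_holds hΔ h1 h2'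

/-- **Item closer** (route `JensenPolynomials`, glue item `XiGorttwCoeffSmallFarOfSplit`, stmt-RiemannHypothesis-19473):
the δ-floor is the landed theorem `two_mul_gorttwDeltaSq_ge` (item `XiDeltaLower052`). RH-FREE. -/
theorem xiGorttwCoeffSmallFarOfSplit_item :
    Summit.RiemannHypothesis.RiemannHypothesis.Theses.JensenPolynomials.XiGorttwCoeffSmallFarOfSplit :=
  fun hB1 hq h2 => xiGorttwCoeffSmallFar_of_split4 hB1 two_mul_gorttwDeltaSq_ge hq h2

end Summit.RiemannHypothesis.RiemannHypothesis.Theorems.JensenPolynomials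

end
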